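import Mathlib.Probability.Distributions.Gaussian.Real
import Mathlib.Combinatorics.SimpleGraph.AdjMatrix
import Mathlib.Analysis.SpecialFunctions.Artanh
import Mathlib.Analysis.SpecialFunctions.Trigonometric.Basic
import Mathlib.Topology.Instances.Matrix
import Mathlib.MeasureTheory.Measure.Prod
import Mathlib.LinearAlgebra.Matrix.Notation
import Literature.Probability.LatticeModels.IsingModel
import HarnessLib

/-!
# The Hubbard–Stratonovich (Kac–Siegert) Langevin pair chain with common noise

Topic `Literature/Probability/LatticeModels`; definition request `defn-HSLangevinPairChain` (route
CriticalPhenomena/Ising3DConformalLimit `SynchronousCoupling`, cruxes `DilationJoinings`,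
`RotationJoining`; wanted so that the layer-2 children `HSSyncTorus` / `HSSyncRotBox` can be typed).

## The objects (namespace `Literature.Probability.LatticeModels.HSLangevin`)

Fix a finite set of sites `V` and a symmetric COUPLING OPERATOR `M : Matrix V V ℝ`; for the
nearest-neighbour Ising model `M = κ·1 + β·J` with `J` the adjacency matrix (`couplingMatrix`,
torus instance `Mop d κ β N` on `(ℤ/Nℤ)^d`, free-box instance `Mfree Λ κ β` on `Λ ⊆ ℤ^d`), and
`κ > 2dβ` makes `M` positive definite without changing the Gibbs measure (`σ_x² = 1`).

*Kac–Siegert / Hubbard–Stratonovich field.* Completing the square,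
`exp(½ σᵀMσ) ∝ ∫ exp(-½ ψᵀMψ + σᵀMψ) dψ`, so the zero-field Ising measure with weight
`exp(½ σᵀMσ) = e^{κ|V|/2} exp(β ∑_{x∼y} σ_xσ_y)` is the `σ`-marginal of the joint law
`∝ exp(-½ ψᵀMψ + σᵀMψ) dψ`; conditionally on the field `ψ : V → ℝ` the spins are INDEPENDENT with
`P(σ_x = 1 | ψ) = (1 + tanh((Mψ)_x))/2`, `E[σ_x | ψ] = tanh((Mψ)_x)` (`tanhField`, `readoutProb`),
and the `ψ`-marginal is `∝ exp(-½ ψᵀMψ) ∏_x 2cosh((Mψ)_x) dψ`, i.e. `e^{-U(ψ)}dψ` with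
`U(ψ) = ½ ψᵀMψ - ∑_x log cosh((Mψ)_x)`. This is the `t = 0` case of the Gaussian decomposition of
the Ising measure in Bauerschmidt–Dagallier (CPAM 2024, arXiv:2202.02301) §1.2 and
Bauerschmidt–Bodineau–Dagallier (Probab. Surveys 2024) §6.4.1 (there the Gaussian variable is
`φ = M ψ` up to their normalisation `C_0^{-1} = α`); the preconditioned variable `ψ = M⁻¹φ` is the
route's choice (card kac-siegert-cross-mesh-synchronisation) and is what is typed here.

*Dynamics.* `∇U(ψ) = M(ψ - tanh(Mψ))`, so the Langevin dynamics preconditioned by `M⁻¹`,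
`dψ = (tanh(Mψ) - ψ) dt + √2 · M^{-1/2} dW`, is reversible for `e^{-U}` (BBD 2024 §2.1, the
Glauber–Langevin SDE `dφ = -∇H dt + √2 dB`). Its drift `drift M ψ = tanh(Mψ) - ψ` is COOPERATIVE
when `M` has nonnegative off-diagonal entries (ferromagnet), which makes the synchronous (= common
noise) coupling ORDER PRESERVING (Flandoli–Gess–Scheutzow, Ann. Probab. 45 (2017), App. A;
proved here for the Euler map: `eulerStep_mono`). We type the explicit Euler–Maruyama step
`eulerStep M Q h ψ ξ = ψ + h • drift M ψ + √(2h) • Q ξ` with a RECTANGULAR noise factor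
`Q : Matrix V ι ℝ` acting on a standard Gaussian vector `ξ : ι → ℝ` (`noise ι`, the product of
`gaussianReal 0 1`): the one-lattice chain takes `ι = V`, `Q` a symmetric square root of `M⁻¹`
(DATA, the hypothesis `Q * Q = M⁻¹` belongs to the user's statement); the rotated-box chain of
`RotationJoining` takes `Q * B` with `B` a Gram factor of the cell-overlap covariance
(`cellOverlap`). The PAIR CHAIN `pairStep` advances two copies (possibly on different lattices
`V₁`, `V₂`, with their own `M, Q, h` — unequal `h` encode the clock ratio `p^z`) with ONE noise draw
`ξ`, the second copy reading it through a noise map `T` (identity; or the block-noise map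
`HSLangevin.blockNoise p L` of the sibling file `HSLangevinBlocks.lean`, the normalised `p`-cell sums
of fine torus noise; or a Gram factor). `eulerChain` / `pairChain` iterate along a noise sequence;
`IsStationary step ν π` (probability law `π` invariant under the random map `x ↦ step x ξ`, `ξ ∼ ν`,
written with `∫⁻` of the push-forward) and `IsStationaryPair` are the stationarity predicates the
children quantify over.

## What is NOT here
Lattice-specific read-outs and noises (torus `p`-cells, `blockNoise`, `tanhBlock`, axis / rotated
cubes `axisTanhBlock` / `rotTanhBlock`, the rotation numerator `A`, cell overlaps for the Gram
factor) are in `HSLangevinBlocks.lean`; the Kac–Siegert MEASURE on fields and the exactness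
identities (`E tanh((Mψ)_x) tanh((Mψ)_y) = ⟨σ_xσ_y⟩` for `x ≠ y`, and the `σ`-marginal statement)
are theorems about a further measure-valued definition (`KacSiegertTransform.lean`); continuous
time, infinite volume and the `h → 0`, `L → ∞` transfers are the route's business. No named facts
(unproved `Prop` definitions) are introduced in this file.
-/

noncomputable section

open MeasureTheory ProbabilityTheory Matrix Finset

namespace Literature.Probability.LatticeModels

namespace HSLangevin

/-! ### The coupling operator `M = κ·1 + β·J` -/

section Coupling

variable {V : Type*} [DecidableEq V]

/-- The coupling operator `M = κ·1 + β·J` of a pair interaction on the graph `G` (`J` = adjacency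
matrix): the matrix of the quadratic form `½ σᵀMσ = ½κ|V| + β ∑_{x∼y} σ_xσ_y` whose exponential is
the zero-field Ising weight up to the constant `e^{κ|V|/2}`; `κ` large makes `M` positive definite
("adding a diagonal matrix without changing the Ising model", Bauerschmidt–Dagallier §1.1). [cite: BauerschmidtDagallier2023, §1.1] -/
def couplingMatrix (G : SimpleGraph V) [DecidableRel G.Adj] (κ β : ℝ) : Matrix V V ℝ :=
  κ • (1 : Matrix V V ℝ) + β • G.adjMatrix ℝ

/-- Entries of the coupling operator: `κ` on the diagonal, `β` on edges, `0` elsewhere. [cite: BauerschmidtDagallier2023, §1.1] -/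
theorem couplingMatrix_apply (G : SimpleGraph V) [DecidableRel G.Adj] (κ β : ℝ) (x y : V) :
    couplingMatrix G κ β x y = (if x = y then κ else 0) + if G.Adj x y then β else 0 := by
  simp [couplingMatrix, Matrix.one_apply, SimpleGraph.adjMatrix_apply]

/-- The coupling operator is symmetric. [cite: BauerschmidtDagallier2023, §1.1] -/
theorem couplingMatrix_isSymm (G : SimpleGraph V) [DecidableRel G.Adj] (κ β : ℝ) :
    (couplingMatrix G κ β).IsSymm := by
  ext x y
  simp only [transpose_apply, couplingMatrix_apply, eq_comm, G.adj_comm]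

/-- For `κ, β ≥ 0` (ferromagnet) every entry of the coupling operator is nonnegative; this is the
cooperativity behind order preservation (`eulerStep_mono`). [folklore] -/
theorem couplingMatrix_nonneg (G : SimpleGraph V) [DecidableRel G.Adj] {κ β : ℝ} (hκ : 0 ≤ κ)
    (hβ : 0 ≤ β) (x y : V) : 0 ≤ couplingMatrix G κ β x y := by
  rw [couplingMatrix_apply]
  split_ifs <;> linarith

/-- `Mop d κ β N = κ·1 + β·J` on the discrete torus `(ℤ/Nℤ)^d` (periodic boundary condition; the
fine and coarse lattices of `DilationJoinings` are `N = pL` and `N = L`). [folklore] -/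
def Mop (d : ℕ) (κ β : ℝ) (N : ℕ) : Matrix (TorusSite d N) (TorusSite d N) ℝ :=
  couplingMatrix (torusGraph d N) κ β

/-- `Mfree Λ κ β = κ·1 + β·J_Λ` on a finite box `Λ ⊆ ℤ^d` with FREE boundary condition (`J_Λ` =
adjacency of the subgraph of `ℤ^d` induced on `Λ`; the setting of `RotationJoining`). [folklore] -/
def Mfree {d : ℕ} (Λ : Finset (Site d)) (κ β : ℝ) : Matrix Λ Λ ℝ :=
  couplingMatrix ((zdGraph d).induce (Λ : Set (Site d))) κ β

end Coupling

/-! ### Drift, conditional means, Euler step, pair step -/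

section Dynamics

variable {V ι : Type*} [Fintype V] [Fintype ι]

/-- The conditional spin mean given the Kac–Siegert field: `tanhField M ψ x = tanh((Mψ)_x) =
E[σ_x | ψ]` (spins are conditionally independent Bernoulli with external field `Mψ`; BBD 2024
§6.4.1, `t = 0`: "the infinite temperature (product) Ising model with external field"). [cite: BauerschmidtBodineauDagallier2024Polchinski, §6.4.1] -/
def tanhField (M : Matrix V V ℝ) (ψ : V → ℝ) (x : V) : ℝ :=
  Real.tanh ((M *ᵥ ψ) x)

/-- The read-out probability `P(σ_x = 1 | ψ) = (1 + tanh((Mψ)_x))/2` of the conditionally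
independent spins given the field. [cite: BauerschmidtBodineauDagallier2024Polchinski, §6.4.1] -/
def readoutProb (M : Matrix V V ℝ) (ψ : V → ℝ) (x : V) : ℝ :=
  (1 + tanhField M ψ x) / 2

/-- The drift of the `M⁻¹`-preconditioned Kac–Siegert Langevin dynamics,
`drift M ψ = tanh(Mψ) - ψ = -M⁻¹∇U(ψ)` for `U(ψ) = ½ψᵀMψ - ∑ log cosh((Mψ)_x)` (the
Glauber–Langevin SDE `dφ = -∇H(φ)dt + √2 dB`, reversible for `e^{-H}`, of BBD 2024 §2.1, after the
linear change of variables `φ = M^{1/2}ψ`, `H(φ) = U(M^{-1/2}φ)`). [cite: BauerschmidtBodineauDagallier2024Polchinski, §2.1] -/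
def drift (M : Matrix V V ℝ) (ψ : V → ℝ) : V → ℝ :=
  fun x => tanhField M ψ x - ψ x

/-- `drift` in coordinates. [cite: BauerschmidtBodineauDagallier2024Polchinski, §2.1] -/
@[simp] theorem drift_apply (M : Matrix V V ℝ) (ψ : V → ℝ) (x : V) :
    drift M ψ x = Real.tanh ((M *ᵥ ψ) x) - ψ x := rfl

/-- One Euler–Maruyama step of `dψ = (tanh(Mψ) - ψ)dt + √2·Q dW` with time step `h` and noise
factor `Q : Matrix V ι ℝ` applied to the standard Gaussian draw `ξ : ι → ℝ`:
`ψ ↦ ψ + h • drift M ψ + √(2h) • Qξ`. For the one-lattice chain `ι = V` and `Q` is a symmetric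
square root of `M⁻¹`; rectangular `Q` covers Gram-factor noises. [folklore] -/
def eulerStep (M : Matrix V V ℝ) (Q : Matrix V ι ℝ) (h : ℝ) (ψ : V → ℝ) (ξ : ι → ℝ) : V → ℝ :=
  ψ + h • drift M ψ + Real.sqrt (2 * h) • (Q *ᵥ ξ)

/-- `eulerStep` in coordinates. [folklore] -/
theorem eulerStep_apply (M : Matrix V V ℝ) (Q : Matrix V ι ℝ) (h : ℝ) (ψ : V → ℝ)
    (ξ : ι → ℝ) (x : V) :
    eulerStep M Q h ψ ξ x =
      ψ x + h * (Real.tanh ((M *ᵥ ψ) x) - ψ x) + Real.sqrt (2 * h) * (Q *ᵥ ξ) x := rfl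

/-- With zero noise draw the Euler step is the deterministic explicit Euler step of the drift. [folklore] -/
@[simp] theorem eulerStep_zero_noise (M : Matrix V V ℝ) (Q : Matrix V ι ℝ) (h : ℝ)
    (ψ : V → ℝ) : eulerStep M Q h ψ (0 : ι → ℝ) = ψ + h • drift M ψ := by
  simp [eulerStep]

/-- `ψ ↦ (Mψ)_x` is monotone when row `x` of `M` is nonnegative. [folklore] -/
theorem mulVec_mono {M : Matrix V V ℝ} (hM : ∀ x y, 0 ≤ M x y) (x : V) :
    Monotone fun ψ : V → ℝ => (M *ᵥ ψ) x := by
  intro ψ ψ' hle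
  simp only [mulVec, dotProduct]
  exact Finset.sum_le_sum fun y _ => mul_le_mul_of_nonneg_left (hle y) (hM x y)

/-- ORDER PRESERVATION of the synchronous coupling (Flandoli–Gess–Scheutzow 2017, App. A:
"order-preserving RDS"): if all entries of `M` are nonnegative (ferromagnet, `κ, β ≥ 0`) and
`0 ≤ h ≤ 1`, the Euler map driven by a FIXED noise draw `ξ` is monotone for the coordinatewise
order, since `ψ + h(tanh(Mψ) - ψ) = (1-h)ψ + h·tanh(Mψ)` and `tanh`, `ψ ↦ Mψ` are monotone. [cite: FlandoliGessScheutzow2017, Appendix A] -/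
theorem eulerStep_mono {M : Matrix V V ℝ} (hM : ∀ x y, 0 ≤ M x y) (Q : Matrix V ι ℝ)
    {h : ℝ} (h0 : 0 ≤ h) (h1 : h ≤ 1) (ξ : ι → ℝ) :
    Monotone fun ψ : V → ℝ => eulerStep M Q h ψ ξ := by
  -- `tanh` is monotone (via strict monotonicity of `artanh` on `(-1, 1)`; the tree's
  -- `tanh_le_tanh` lives in files too heavy to import here)
  have tanh_mono : Monotone Real.tanh := fun a b hab => by
    have ha : Real.tanh a ∈ Set.Ioo (-1 : ℝ) 1 := ⟨Real.neg_one_lt_tanh a, Real.tanh_lt_one a⟩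
    have hb : Real.tanh b ∈ Set.Ioo (-1 : ℝ) 1 := ⟨Real.neg_one_lt_tanh b, Real.tanh_lt_one b⟩
    rw [← Real.artanh_le_artanh_iff ha hb, Real.artanh_tanh, Real.artanh_tanh]
    exact hab
  intro ψ ψ' hle x
  simp only [eulerStep_apply]
  have h₁ : Real.tanh ((M *ᵥ ψ) x) ≤ Real.tanh ((M *ᵥ ψ') x) :=
    tanh_mono (mulVec_mono hM x hle)
  have h₂ : ψ x ≤ ψ' x := hle x
  nlinarith [mul_le_mul_of_nonneg_left h₁ h0, mul_le_mul_of_nonneg_left h₂ (sub_nonneg.2 h1)]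

/-- The Euler map is jointly continuous in (state, noise). [folklore] -/
theorem continuous_eulerStep (M : Matrix V V ℝ) (Q : Matrix V ι ℝ) (h : ℝ) :
    Continuous fun p : (V → ℝ) × (ι → ℝ) => eulerStep M Q h p.1 p.2 := by
  have continuous_tanh : Continuous Real.tanh := by
    have h : Real.tanh = fun t => Real.sinh t / Real.cosh t := funext Real.tanh_eq_sinh_div_cosh
    rw [h]
    exact Real.continuous_sinh.div Real.continuous_cosh fun t => (Real.cosh_pos t).ne'
  apply continuous_pi
  intro x
  simp only [eulerStep_apply]
  have hmv : Continuous fun p : (V → ℝ) × (ι → ℝ) => (M *ᵥ p.1) x :=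
    (continuous_apply x).comp (continuous_const.matrix_mulVec continuous_fst)
  have hQ : Continuous fun p : (V → ℝ) × (ι → ℝ) => (Q *ᵥ p.2) x :=
    (continuous_apply x).comp (continuous_const.matrix_mulVec continuous_snd)
  have hψ : Continuous fun p : (V → ℝ) × (ι → ℝ) => p.1 x := (continuous_apply x).comp continuous_fst
  exact ((hψ.add (continuous_const.mul ((continuous_tanh.comp hmv).sub hψ))).add
    (continuous_const.mul hQ))

/-- The Euler map is jointly measurable in (state, noise) (so it defines a Markov kernel). [folklore] -/
theorem measurable_eulerStep (M : Matrix V V ℝ) (Q : Matrix V ι ℝ) (h : ℝ) :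
    Measurable fun p : (V → ℝ) × (ι → ℝ) => eulerStep M Q h p.1 p.2 :=
  (continuous_eulerStep M Q h).measurable

/-- The Euler CHAIN driven by a noise sequence `ξ : ℕ → ι → ℝ` from the initial field `ψ₀`:
`ψ_{n+1} = eulerStep M Q h ψ_n ξ_n`. [folklore] -/
def eulerChain (M : Matrix V V ℝ) (Q : Matrix V ι ℝ) (h : ℝ) (ξ : ℕ → ι → ℝ) (ψ₀ : V → ℝ) :
    ℕ → V → ℝ
  | 0 => ψ₀
  | n + 1 => eulerStep M Q h (eulerChain M Q h ξ ψ₀ n) (ξ n)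

/-- `eulerChain` at time `0`. [folklore] -/
@[simp] theorem eulerChain_zero (M : Matrix V V ℝ) (Q : Matrix V ι ℝ) (h : ℝ) (ξ : ℕ → ι → ℝ)
    (ψ₀ : V → ℝ) : eulerChain M Q h ξ ψ₀ 0 = ψ₀ := rfl

/-- `eulerChain` one step on. [folklore] -/
@[simp] theorem eulerChain_succ (M : Matrix V V ℝ) (Q : Matrix V ι ℝ) (h : ℝ) (ξ : ℕ → ι → ℝ)
    (ψ₀ : V → ℝ) (n : ℕ) :
    eulerChain M Q h ξ ψ₀ (n + 1) = eulerStep M Q h (eulerChain M Q h ξ ψ₀ n) (ξ n) := rfl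

/-- Two Euler chains driven by the SAME noise sequence stay ordered if they start ordered
(synchronous coupling is order preserving; Flandoli–Gess–Scheutzow 2017, App. A). [cite: FlandoliGessScheutzow2017, Appendix A] -/
theorem eulerChain_mono {M : Matrix V V ℝ} (hM : ∀ x y, 0 ≤ M x y) (Q : Matrix V ι ℝ)
    {h : ℝ} (h0 : 0 ≤ h) (h1 : h ≤ 1) (ξ : ℕ → ι → ℝ) {ψ₀ ψ₀' : V → ℝ} (hle : ψ₀ ≤ ψ₀') (n : ℕ) :
    eulerChain M Q h ξ ψ₀ n ≤ eulerChain M Q h ξ ψ₀' n := by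
  induction n with
  | zero => simpa using hle
  | succ n ih => exact eulerStep_mono hM Q h0 h1 (ξ n) ih

variable {V₁ V₂ ι₂ : Type*} [Fintype V₁] [Fintype V₂] [Fintype ι₂]

/-- One step of the PAIR CHAIN WITH COMMON NOISE: two Euler chains (coupling operators `M₁, M₂`,
noise factors `Q₁, Q₂`, time steps `h₁, h₂` — unequal steps encode a clock ratio) advanced with
ONE noise draw `ξ`, the second copy reading it through the noise map `T` (`id` for equal
lattices; `blockNoise p L` for the dilation pair; a Gram factor for the rotation pair). This is the
synchronous coupling of Flandoli–Gess–Scheutzow 2017 (two initial conditions, one noise) extended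
across two lattices (card kac-siegert-cross-mesh-synchronisation). [cite: FlandoliGessScheutzow2017, Appendix A] -/
def pairStep (M₁ : Matrix V₁ V₁ ℝ) (Q₁ : Matrix V₁ ι ℝ) (h₁ : ℝ) (M₂ : Matrix V₂ V₂ ℝ)
    (Q₂ : Matrix V₂ ι₂ ℝ) (h₂ : ℝ) (T : (ι → ℝ) → (ι₂ → ℝ)) (ψ : (V₁ → ℝ) × (V₂ → ℝ))
    (ξ : ι → ℝ) : (V₁ → ℝ) × (V₂ → ℝ) :=
  (eulerStep M₁ Q₁ h₁ ψ.1 ξ, eulerStep M₂ Q₂ h₂ ψ.2 (T ξ))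

/-- First component of the pair step. [folklore] -/
@[simp] theorem pairStep_fst (M₁ : Matrix V₁ V₁ ℝ) (Q₁ : Matrix V₁ ι ℝ) (h₁ : ℝ)
    (M₂ : Matrix V₂ V₂ ℝ) (Q₂ : Matrix V₂ ι₂ ℝ) (h₂ : ℝ) (T : (ι → ℝ) → (ι₂ → ℝ))
    (ψ : (V₁ → ℝ) × (V₂ → ℝ)) (ξ : ι → ℝ) :
    (pairStep M₁ Q₁ h₁ M₂ Q₂ h₂ T ψ ξ).1 = eulerStep M₁ Q₁ h₁ ψ.1 ξ := rfl

/-- Second component of the pair step. [folklore] -/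
@[simp] theorem pairStep_snd (M₁ : Matrix V₁ V₁ ℝ) (Q₁ : Matrix V₁ ι ℝ) (h₁ : ℝ)
    (M₂ : Matrix V₂ V₂ ℝ) (Q₂ : Matrix V₂ ι₂ ℝ) (h₂ : ℝ) (T : (ι → ℝ) → (ι₂ → ℝ))
    (ψ : (V₁ → ℝ) × (V₂ → ℝ)) (ξ : ι → ℝ) :
    (pairStep M₁ Q₁ h₁ M₂ Q₂ h₂ T ψ ξ).2 = eulerStep M₂ Q₂ h₂ ψ.2 (T ξ) := rfl

/-- The pair step is jointly measurable in (state, noise) when the noise map is. [folklore] -/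
theorem measurable_pairStep (M₁ : Matrix V₁ V₁ ℝ) (Q₁ : Matrix V₁ ι ℝ)
    (h₁ : ℝ) (M₂ : Matrix V₂ V₂ ℝ) (Q₂ : Matrix V₂ ι₂ ℝ) (h₂ : ℝ) {T : (ι → ℝ) → (ι₂ → ℝ)}
    (hT : Measurable T) :
    Measurable fun p : ((V₁ → ℝ) × (V₂ → ℝ)) × (ι → ℝ) => pairStep M₁ Q₁ h₁ M₂ Q₂ h₂ T p.1 p.2 := by
  refine Measurable.prodMk ?_ ?_
  · exact (measurable_eulerStep M₁ Q₁ h₁).comp (measurable_fst.fst.prodMk measurable_snd)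
  · exact (measurable_eulerStep M₂ Q₂ h₂).comp
      (measurable_fst.snd.prodMk (hT.comp measurable_snd))

/-- The PAIR CHAIN driven by a common noise sequence. [cite: FlandoliGessScheutzow2017, Appendix A] -/
def pairChain (M₁ : Matrix V₁ V₁ ℝ) (Q₁ : Matrix V₁ ι ℝ) (h₁ : ℝ) (M₂ : Matrix V₂ V₂ ℝ)
    (Q₂ : Matrix V₂ ι₂ ℝ) (h₂ : ℝ) (T : (ι → ℝ) → (ι₂ → ℝ)) (ξ : ℕ → ι → ℝ)
    (ψ₀ : (V₁ → ℝ) × (V₂ → ℝ)) : ℕ → (V₁ → ℝ) × (V₂ → ℝ)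
  | 0 => ψ₀
  | n + 1 => pairStep M₁ Q₁ h₁ M₂ Q₂ h₂ T (pairChain M₁ Q₁ h₁ M₂ Q₂ h₂ T ξ ψ₀ n) (ξ n)

/-- The pair chain is the pair of Euler chains driven by `ξ` and `T ∘ ξ`. [folklore] -/
theorem pairChain_eq (M₁ : Matrix V₁ V₁ ℝ) (Q₁ : Matrix V₁ ι ℝ) (h₁ : ℝ) (M₂ : Matrix V₂ V₂ ℝ)
    (Q₂ : Matrix V₂ ι₂ ℝ) (h₂ : ℝ) (T : (ι → ℝ) → (ι₂ → ℝ)) (ξ : ℕ → ι → ℝ)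
    (ψ₀ : (V₁ → ℝ) × (V₂ → ℝ)) (n : ℕ) :
    pairChain M₁ Q₁ h₁ M₂ Q₂ h₂ T ξ ψ₀ n =
      (eulerChain M₁ Q₁ h₁ ξ ψ₀.1 n, eulerChain M₂ Q₂ h₂ (fun k => T (ξ k)) ψ₀.2 n) := by
  induction n with
  | zero => rfl
  | succ n ih => simp [pairChain, ih, pairStep]

end Dynamics

/-! ### Noise: standard Gaussian vectors -/

section Noise

/-- The law of the driving noise draw: the standard Gaussian vector on `ι → ℝ`, i.e. the product of
`gaussianReal 0 1` (i.i.d. `N(0,1)` coordinates). [folklore] -/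
def noise (ι : Type*) [Fintype ι] : Measure (ι → ℝ) :=
  Measure.pi fun _ : ι => gaussianReal 0 1

/-- `noise ι` is a probability measure. [folklore] -/
instance noise.instIsProbabilityMeasure (ι : Type*) [Fintype ι] :
    IsProbabilityMeasure (noise ι) := by
  unfold noise; infer_instance


end Noise

/-! ### Stationary laws of the random maps -/

section Stationary

variable {X Ξ : Type*} [MeasurableSpace X] [MeasurableSpace Ξ]

/-- A law `π` on the state space is STATIONARY for the random map `x ↦ step x ξ`, `ξ ∼ ν`, if it is
a probability measure and `π(s) = ∫ ν{ξ | step x ξ ∈ s} π(dx)` for every measurable `s`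
(invariance under the one-step Markov kernel, written with the push-forward `ν.map (step x)`;
Flandoli–Gess–Scheutzow 2017, App. A, invariant measures of the Markov semigroup `P_t`). [cite: FlandoliGessScheutzow2017, Appendix A] -/
def IsStationary (step : X → Ξ → X) (ν : Measure Ξ) (π : Measure X) : Prop :=
  IsProbabilityMeasure π ∧ ∀ s : Set X, MeasurableSet s → ∫⁻ x, (ν.map (step x)) s ∂π = π s

/-- A stationary law is a probability measure. [folklore] -/
theorem IsStationary.isProbabilityMeasure {step : X → Ξ → X} {ν : Measure Ξ} {π : Measure X}
    (h : IsStationary step ν π) : IsProbabilityMeasure π := h.1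

/-- The invariance identity of a stationary law. [folklore] -/
theorem IsStationary.lintegral_map_eq {step : X → Ξ → X} {ν : Measure Ξ} {π : Measure X}
    (h : IsStationary step ν π) {s : Set X} (hs : MeasurableSet s) :
    ∫⁻ x, (ν.map (step x)) s ∂π = π s := h.2 s hs

variable {V V₁ V₂ ι ι₂ : Type*} [Fintype V] [Fintype V₁] [Fintype V₂] [Fintype ι] [Fintype ι₂]

/-- Stationarity of a law of fields under the one-lattice Euler chain with Gaussian noise. [folklore] -/
def IsStationaryField (M : Matrix V V ℝ) (Q : Matrix V ι ℝ) (h : ℝ) (π : Measure (V → ℝ)) :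
    Prop :=
  IsStationary (eulerStep M Q h) (noise ι) π

/-- `IsStationaryPair M₁ Q₁ h₁ M₂ Q₂ h₂ T π`: the law `π` of a PAIR of fields is stationary for the
common-noise pair chain `pairStep M₁ Q₁ h₁ M₂ Q₂ h₂ T` driven by `ξ ∼ noise ι` (the object the
children `HSSyncTorus` / `HSSyncRotBox` quantify over: a stationary synchronous coupling). [cite: FlandoliGessScheutzow2017, Appendix A] -/
def IsStationaryPair (M₁ : Matrix V₁ V₁ ℝ) (Q₁ : Matrix V₁ ι ℝ) (h₁ : ℝ) (M₂ : Matrix V₂ V₂ ℝ)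
    (Q₂ : Matrix V₂ ι₂ ℝ) (h₂ : ℝ) (T : (ι → ℝ) → (ι₂ → ℝ))
    (π : Measure ((V₁ → ℝ) × (V₂ → ℝ))) : Prop :=
  IsStationary (pairStep M₁ Q₁ h₁ M₂ Q₂ h₂ T) (noise ι) π

/-- The one-step kernel `x ↦ (noise ι).map (step x)` of a jointly measurable random map is
measurable set by set (a Markov kernel). [folklore] -/
theorem measurable_noise_map_apply {step : X → (ι → ℝ) → X}
    (hstep : Measurable fun p : X × (ι → ℝ) => step p.1 p.2) {s : Set X} (hs : MeasurableSet s) :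
    Measurable fun x => (noise ι).map (step x) s := by
  have hx : ∀ x, Measurable (step x) := fun x => hstep.comp (measurable_const.prodMk measurable_id)
  simp_rw [Measure.map_apply (hx _) hs]
  exact measurable_measure_prodMk_left (hstep hs)

/-- The first marginal of a stationary pair law is stationary for the first Euler chain (the pair
chain is a COUPLING of the two one-lattice chains). [folklore] -/
theorem IsStationaryPair.fst {M₁ : Matrix V₁ V₁ ℝ} {Q₁ : Matrix V₁ ι ℝ} {h₁ : ℝ}
    {M₂ : Matrix V₂ V₂ ℝ} {Q₂ : Matrix V₂ ι₂ ℝ} {h₂ : ℝ} {T : (ι → ℝ) → (ι₂ → ℝ)}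
    {π : Measure ((V₁ → ℝ) × (V₂ → ℝ))} (hT : Measurable T)
    (h : IsStationaryPair M₁ Q₁ h₁ M₂ Q₂ h₂ T π) : IsStationaryField M₁ Q₁ h₁ π.fst := by
  haveI := h.1
  have hpair : ∀ ψ : (V₁ → ℝ) × (V₂ → ℝ), Measurable (pairStep M₁ Q₁ h₁ M₂ Q₂ h₂ T ψ) := fun ψ =>
    (measurable_pairStep M₁ Q₁ h₁ M₂ Q₂ h₂ hT).comp (measurable_const.prodMk measurable_id)
  have hone : ∀ φ : V₁ → ℝ, Measurable (eulerStep M₁ Q₁ h₁ φ) := fun φ =>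
    (measurable_eulerStep M₁ Q₁ h₁).comp (measurable_const.prodMk measurable_id)
  refine ⟨inferInstance, fun s hs => ?_⟩
  rw [Measure.fst_apply hs, ← h.2 _ (measurable_fst hs), Measure.fst,
    lintegral_map (measurable_noise_map_apply (measurable_eulerStep M₁ Q₁ h₁) hs) measurable_fst]
  refine lintegral_congr fun ψ => ?_
  rw [Measure.map_apply (hone ψ.1) hs, Measure.map_apply (hpair ψ) (measurable_fst hs)]
  rfl

/-- The second marginal of a stationary pair law is stationary for the second Euler chain driven by
the transformed noise `T ξ` — provided `T` pushes `noise ι` forward to `noise ι₂` (as the block-sum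
and Gram-factor maps do). [folklore] -/
theorem IsStationaryPair.snd {M₁ : Matrix V₁ V₁ ℝ} {Q₁ : Matrix V₁ ι ℝ} {h₁ : ℝ}
    {M₂ : Matrix V₂ V₂ ℝ} {Q₂ : Matrix V₂ ι₂ ℝ} {h₂ : ℝ} {T : (ι → ℝ) → (ι₂ → ℝ)}
    {π : Measure ((V₁ → ℝ) × (V₂ → ℝ))} (hT : Measurable T) (hTν : (noise ι).map T = noise ι₂)
    (h : IsStationaryPair M₁ Q₁ h₁ M₂ Q₂ h₂ T π) : IsStationaryField M₂ Q₂ h₂ π.snd := by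
  haveI := h.1
  have hpair : ∀ ψ : (V₁ → ℝ) × (V₂ → ℝ), Measurable (pairStep M₁ Q₁ h₁ M₂ Q₂ h₂ T ψ) := fun ψ =>
    (measurable_pairStep M₁ Q₁ h₁ M₂ Q₂ h₂ hT).comp (measurable_const.prodMk measurable_id)
  have hone : ∀ φ : V₂ → ℝ, Measurable (eulerStep M₂ Q₂ h₂ φ) := fun φ =>
    (measurable_eulerStep M₂ Q₂ h₂).comp (measurable_const.prodMk measurable_id)
  refine ⟨inferInstance, fun s hs => ?_⟩
  rw [Measure.snd_apply hs, ← h.2 _ (measurable_snd hs), Measure.snd,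
    lintegral_map (measurable_noise_map_apply (measurable_eulerStep M₂ Q₂ h₂) hs) measurable_snd]
  refine lintegral_congr fun ψ => ?_
  rw [Measure.map_apply (hone ψ.2) hs, Measure.map_apply (hpair ψ) (measurable_snd hs), ← hTν,
    Measure.map_apply hT ((hone ψ.2) hs)]
  rfl

end Stationary

end HSLangevin

end Literature.Probability.LatticeModels
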